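import Literature.AnabelianGeometry.EtaleTheta.TemperedFrobenioidProps
import Literature.AnabelianGeometry.EtaleTheta.FrdIVocabulary
import Literature.AnabelianGeometry.EtaleTheta.Discharge.Sec3Thm37
import Literature.AlgebraicGeometry.Frobenioids.ModelFrobenioidOrder
import Literature.AlgebraicGeometry.Frobenioids.ModelFrobenioidPreSteps
import Literature.AlgebraicGeometry.Frobenioids.ModelFrobenioidPowerFunctor
import Literature.AlgebraicGeometry.Frobenioids.PrimaryStepsTransport
import Literature.AlgebraicGeometry.Frobenioids.CoAngular

/-!
# [EtTh] Corollary 3.8 (iii), first clause — the CATEGORICAL characterisation of non-cuspidal and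
# cuspidal pre-steps inside ONE tempered Frobenioid (engine of the transfer along `Ψ : C₁ ⥲ C₂`)

Mochizuki, *The étale theta function and its Frobenioid-theoretic manifestations*, Publ. RIMS **45**
(2009), Cor. 3.8 (iii), PDF p.81 (printed 307) [cite: MochizukiEtTh2009, Cor 3.8 p.81]:
"Suppose that `Ψ` preserves the base-field-theoretic morphisms, and that `Φ₁`, `Φ₂` are cuspidally
pure. Then `Ψ` preserves the non-cuspidal and cuspidal pre-steps."  Printed proof (p.82 = printed 308):
"Since, by assumption, `Ψ` preserves the base-field-theoretic pre-steps, we conclude from Definition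
3.6, (v), (a) [cf. also the first equivalence of categories involving pre-steps of [Mzk17], Definition
1.3, (iii), (d)], that `Ψ` preserves the primary non-cuspidal steps, hence, [by Definition 3.6, (v),
(b)] that `Ψ` preserves the primary cuspidal steps. Thus, by considering the 'factorization
homomorphisms' arising from the fact that `Φ₁`, `Φ₂` are perf-factorial [cf. [Mzk17], Definition 2.4,
(i), (c)] in the context of the perfections of `C₁`, `C₂`, it follows that `Ψ` preserves the
non-cuspidal and cuspidal pre-steps."

abc-iut cell, layer L2, node `EtTh:Cor3.8(iii)` (typer abc-iut-L2-t3: `Cor38_iii` in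
`TemperedFrobenioidProps.lean`; prover abc-iut-L2-d2).  THIS FILE (theorems only, no definitions) is
the single-Frobenioid half of the proof, for a tempered Frobenioid `C` over the tree vocabulary
(`treeMonoidVocab`: `Φ(A)` genuinely perf-factorial, hence divisorial and sharp) whose Frobenioid is the
REAL model-Frobenioid category `C.category` ([FrdI] Thm 5.2 (i), `TemperedFrobenioidModel.lean`):

* Def. 3.6 (v)(a) + [FrdI] Def. 1.3 (iii)(d) for the model (L1: `ModelFrobenioid.iii_d_under_full` /
  `iii_d_under_surj`): a pre-step `φ : A → B` with PRIMARY zero divisor is non-cuspidal iff some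
  base-field-theoretic pre-step out of `A` factors through `φ` (`isNonCuspidal_div_iff_exists_factor`);
* Def. 3.6 (v)(b): it is then cuspidal iff it is not non-cuspidal
  (`isCuspidal_iff_not_isNonCuspidal`);
* the general pre-step (print: "by considering the factorization homomorphisms …"): its zero divisor
  `x` is non-cuspidal iff every PRIMARY `y ≼ x` is — and `y ≼ x`, i.e. `y ≤ d·x`, is read off
  categorically from the morphism of Frobenius type `(d, id, 0, 0) : (A_D, α) → (A_D, d·α)`
  ([FrdI] Thm 5.2 proof / Prop 2.1 (i); L1 `ModelFrobenioid.powUnitHom`), whose conjugate of `φ` has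
  zero divisor `d·x` (`isNonCuspidal_div_iff_frobenius`, `isCuspidal_div_iff_frobenius`).

INPUTS CARRIED AS EXPLICIT HYPOTHESES (not constructible from the present interface
`RealifiedDivisorMonoids`, whose non-cuspidal / cuspidal parts `ncspR`, `cspR` of `Φ₀^ℝ` are bare
submonoids — interface finding of abc-iut-L2-d2, INBOX 2026-08-25; each is the content of
Def. 3.1 (i)–(ii) p.70 "support in the special fibre / in the divisor of cusps", "a log-meromorphic
function arising from `L^×` [is] constant", with Prop. 3.4 (ii) p.74):
`hD1` — a base-field-theoretic divisor is non-cuspidal; `hDa` — no element `≠ 0` is both;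
`hDn` / `hDc` — non-cuspidality / cuspidality of `x` is the condition that every primary `y ≼ x` be
non-cuspidal / cuspidal (the "support" reading used by the printed factorization-homomorphism step).
Diagrammatic composition (`φ ≫ ψ`); monoids multiplicative (`x ∣ y` is print's `x ≤ y`).
HONEST FRAMING: refereed pre-IUT material; nothing here bears on [IUTchIII] Cor. 3.12.
-/

namespace Literature.AnabelianGeometry.EtaleTheta

namespace TemperedFrobenioid

open CategoryTheory Opposite Literature.AlgebraicGeometry.Frobenioids

universe u₀ v₀ u v w

variable {D₀ : Type u₀} [Category.{v₀} D₀] {T : RealifiedDivisorMonoids (D₀ := D₀) treeMonoidVocab.{w}}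
  {D : Type u} [Category.{v} D] {VD : FrdICatStub.{u, v, w} D} (C : TemperedFrobenioid T D VD)

/-! ### The standing [FrdI] facts about the data of a tempered Frobenioid over the tree vocabulary -/

/-- `Φ(A)` is divisorial (Def 3.6 (ii): perf-factorial, [FrdI] Def 2.4 (i)(a)), objectwise on `D`.
[cite: MochizukiEtTh2009, Def 3.6 p.77] -/
theorem objectwise_isDivisorial : Objectwise (fun M _ => IsDivisorial M) C.divisorMonoid :=
  fun A => (C.isPerfFactorial (op A)).isDivisorial

/-- `B(A) = B₀^Λ|_D ×_{(Φ^{ℝ-log})^gp} Φ^gp` is group-like (since `B₀^Λ` is, Def 3.6 (i)), objectwise — the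
hypothesis `hBg` of L1's [FrdI] Thm 5.2 (ii) lemmas for the model Frobenioid.
[cite: MochizukiEtTh2009, Def 3.6 p.77] -/
theorem objectwise_isGroupLike : Objectwise (fun M _ => IsGroupLike M) C.ratFnFunctor :=
  C.ratFnFunctor_isGroupLike T.isUnit_BΛ

/-! ### Monoid side: Definition 3.6 (v) for PRIMARY elements -/

/-- Down-closure of non-cuspidality under `≤` (from the support reading `hDn`).
[cite: MochizukiEtTh2009, Def 3.6 p.77] -/
theorem isNonCuspidal_of_dvd
    (hDn : ∀ (A : Dᵒᵖ) (x : C.Φ.carrier A),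
      C.IsNonCuspidal x ↔ ∀ y : C.Φ.carrier A, IsPrimary y → Precsim y x → C.IsNonCuspidal y)
    {A : Dᵒᵖ} {x y : C.Φ.carrier A} (hxy : x ∣ y) (hy : C.IsNonCuspidal y) : C.IsNonCuspidal x :=
  (hDn A x).2 fun z hz hzx => (hDn A y).1 hy z hz (hzx.trans (Precsim.of_dvd hxy))

/-- **Definition 3.6 (v)(a), as an equivalence for primary elements**: a primary `x ∈ Φ(A)` is
non-cuspidal iff `x ≤ y` for some base-field-theoretic `y` ("(a) for every non-cuspidal primary element
`x ∈ Φ(A)` … there exists an element `y ∈ Φ^{bs-fld}(A)` such that `x ≤ y`"; the converse is `hD1` and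
down-closure). [cite: MochizukiEtTh2009, Def 3.6 p.78] -/
theorem isNonCuspidal_iff_exists_bsFld_dvd (hp : C.IsCuspidallyPure)
    (hD1 : ∀ (A : Dᵒᵖ) (y : C.Φ.carrier A), C.IsBaseFieldTheoreticDiv y → C.IsNonCuspidal y)
    (hDn : ∀ (A : Dᵒᵖ) (x : C.Φ.carrier A),
      C.IsNonCuspidal x ↔ ∀ y : C.Φ.carrier A, IsPrimary y → Precsim y x → C.IsNonCuspidal y)
    {A : Dᵒᵖ} {x : C.Φ.carrier A} (hx : IsPrimary x) :
    C.IsNonCuspidal x ↔ ∃ y : C.Φ.carrier A, C.IsBaseFieldTheoreticDiv y ∧ x ∣ y :=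
  ⟨fun h => hp.exists_bsFld_dvd A x hx h,
    fun ⟨y, hy, hxy⟩ => C.isNonCuspidal_of_dvd hDn hxy (hD1 A y hy)⟩

/-- **Definition 3.6 (v)(b) for primary elements**: "`Prime(Φ(A)) = Prime(Φ(A))^ncsp ∪ Prime(Φ(A))^csp`"
[disjoint union] gives: a primary element is cuspidal iff it is not non-cuspidal (the prime of `x` is
non-cuspidal or cuspidal; `hDa`: nothing `≠ 0` is both). [cite: MochizukiEtTh2009, Def 3.6 p.78] -/
theorem isCuspidal_iff_not_isNonCuspidal (hp : C.IsCuspidallyPure)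
    (hDa : ∀ (A : Dᵒᵖ) (x : C.Φ.carrier A), C.IsNonCuspidal x → C.IsCuspidal x → x = 1)
    {A : Dᵒᵖ} {x : C.Φ.carrier A} (hx : IsPrimary x) : C.IsCuspidal x ↔ ¬ C.IsNonCuspidal x := by
  refine ⟨fun hc hn => hx.1 (hDa A x hn hc), fun hn => ?_⟩
  rcases hp.ncsp_or_csp A (Quotient.mk (primarySetoid _) ⟨x, hx⟩) with h | h
  · exact absurd (h x ⟨hx, rfl⟩) hn
  · exact h x ⟨hx, rfl⟩

/-! ### The model Frobenioid of `C`: pre-steps out of an object versus `(Φ(A), ≤)`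
([FrdI] Def. 1.3 (iii)(d), L1 `ModelFrobenioidOrder`) -/

variable {C}

/-- Every `x ∈ Φ(A)` is the zero divisor of a pre-step out of `A` (the pre-step `(1, id, x, 0)`;
[FrdI] Def 1.3 (iii)(d) essential surjectivity for the model). [cite: MochizukiFrdI2008, Thm. 5.2(ii) p.101] -/
theorem exists_isPreStep_div_eq (A : C.category) (x : C.Φ.carrier (op A.base)) :
    ∃ (B : C.category) (ψ : A ⟶ B),
      PreFrobenioid.IsPreStep C.toElem ψ ∧ ModelFrobenioid.div ψ = x := by
  obtain ⟨B, ψ, h, hd⟩ := ModelFrobenioid.iii_d_under_surj C.objectwise_isGroupLike A x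
  exact ⟨B, ψ, h.2, hd⟩

/-- If `φ ≫ χ` is a pre-step then `χ` is linear. [cite: MochizukiFrdI2008, Thm. 5.2(i) p.100] -/
theorem degFr_eq_one_of_comp {A B B' : C.category} (φ : A ⟶ B) (χ : B ⟶ B')
    (h : PreFrobenioid.IsPreStep C.toElem (φ ≫ χ)) : ModelFrobenioid.degFr χ = 1 :=
  pnat_eq_one_of_mul_eq_one h.1

/-- `Div(φ) ≤ Div(ψ)` when the pre-step `ψ` factors through `φ` (`Div(χ ∘ φ) = φ^* Div(χ) + Div(φ)` for
linear `χ`). [cite: MochizukiFrdI2008, Thm. 5.2(i) p.100] -/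
theorem div_dvd_div_of_comp_eq {A B B' : C.category} {φ : A ⟶ B} {ψ : A ⟶ B'} (χ : B ⟶ B')
    (hψ : PreFrobenioid.IsPreStep C.toElem ψ) (h : φ ≫ χ = ψ) :
    ModelFrobenioid.div φ ∣ ModelFrobenioid.div ψ := by
  subst h
  have h1 : ModelFrobenioid.degFr χ = 1 := degFr_eq_one_of_comp φ χ hψ
  refine ⟨pull C.divisorMonoid (ModelFrobenioid.baseMap φ) (ModelFrobenioid.div χ), ?_⟩
  rw [ModelFrobenioid.div_comp, h1, PNat.one_coe, pow_one, mul_comm]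
  rfl

/-- `Div(φ) ≤ Div(ψ)` for pre-steps `φ, ψ` out of `A` implies that `ψ` factors through `φ`
([FrdI] Def 1.3 (iii)(d) fullness for the model; every morphism of the model is co-angular).
[cite: MochizukiFrdI2008, Thm. 5.2(ii) p.101] -/
theorem exists_comp_eq_of_div_dvd {A B B' : C.category} {φ : A ⟶ B} {ψ : A ⟶ B'}
    (hφ : PreFrobenioid.IsPreStep C.toElem φ) (hψ : PreFrobenioid.IsPreStep C.toElem ψ)
    (hd : ModelFrobenioid.div φ ∣ ModelFrobenioid.div ψ) : ∃ χ : B ⟶ B', φ ≫ χ = ψ := by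
  obtain ⟨χ, -, hχ⟩ := ModelFrobenioid.iii_d_under_full C.objectwise_isGroupLike φ ψ
    ⟨ModelFrobenioid.isCoAngular C.objectwise_isGroupLike φ, hφ⟩
    ⟨ModelFrobenioid.isCoAngular C.objectwise_isGroupLike ψ, hψ⟩ hd
  exact ⟨χ, hχ⟩

/-- Base-field-theoretic divisors pull back to base-field-theoretic divisors (`Φ^{bs-fld}` is a
subfunctor in monoids, Def 3.6 (ii)(a)). [cite: MochizukiEtTh2009, Def 3.6 p.77] -/
theorem isBaseFieldTheoreticDiv_pull {A Z : D} (g : Z ⟶ A) {y : C.Φ.carrier (op A)}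
    (hy : C.IsBaseFieldTheoreticDiv y) : C.IsBaseFieldTheoreticDiv (pull C.divisorMonoid g y) :=
  C.bsFld.map_mem g.op _ hy

/-! ### Definition 3.6 (v)(a) for primary PRE-STEPS: the first equivalence of categories of
[FrdI] Def. 1.3 (iii)(d) turns "`x ≤ y`, `y ∈ Φ^{bs-fld}(A)`" into "a base-field-theoretic pre-step out of
`A` factors through `φ`" -/

/-- **A primary pre-step `φ : A → B` is non-cuspidal iff some base-field-theoretic pre-step
`ψ : A → B'` factors as `ψ = χ ∘ φ`** (Def 3.6 (v)(a) + [FrdI] Def 1.3 (iii)(d); printed proof of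
Cor 3.8 (iii), p.82). [cite: MochizukiEtTh2009, Cor 3.8 p.82] -/
theorem isNonCuspidal_div_iff_exists_factor (hp : C.IsCuspidallyPure)
    (hD1 : ∀ (A : Dᵒᵖ) (y : C.Φ.carrier A), C.IsBaseFieldTheoreticDiv y → C.IsNonCuspidal y)
    (hDn : ∀ (A : Dᵒᵖ) (x : C.Φ.carrier A),
      C.IsNonCuspidal x ↔ ∀ y : C.Φ.carrier A, IsPrimary y → Precsim y x → C.IsNonCuspidal y)
    {A B : C.category} {φ : A ⟶ B} (hφ : PreFrobenioid.IsPreStep C.toElem φ)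
    (hx : IsPrimary (ModelFrobenioid.div φ)) :
    C.IsNonCuspidal (ModelFrobenioid.div φ) ↔
      ∃ (B' : C.category) (ψ : A ⟶ B') (χ : B ⟶ B'),
        PreFrobenioid.IsPreStep C.toElem ψ ∧ C.IsBaseFieldTheoretic ψ ∧ φ ≫ χ = ψ := by
  rw [C.isNonCuspidal_iff_exists_bsFld_dvd hp hD1 hDn hx]
  constructor
  · rintro ⟨y, hy, hxy⟩
    obtain ⟨B', ψ, hψ, rfl⟩ := exists_isPreStep_div_eq A y
    obtain ⟨χ, hχ⟩ := exists_comp_eq_of_div_dvd hφ hψ hxy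
    exact ⟨B', ψ, χ, hψ, hy, hχ⟩
  · rintro ⟨B', ψ, χ, hψ, hy, hχ⟩
    exact ⟨ModelFrobenioid.div ψ, hy, div_dvd_div_of_comp_eq χ hψ hχ⟩

/-! ### General pre-steps: `y ≼ x` through the morphism of Frobenius type `(d, id, 0, 0)` -/

/-- In a square `φ' ∘ F = F' ∘ φ` with `F`, `F'` of Frobenius type and `deg_Fr(F') = d`, the zero divisor of
`φ'` pulls back to `d · Div(φ)`: `Base(F)^* Div(φ') = d · Div(φ)`.
[cite: MochizukiFrdI2008, Thm. 5.2(i) p.100] -/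
theorem pull_div_eq_pow_of_square {A B A' B'' : C.category} {φ : A ⟶ B} {Fm : A ⟶ A'} {Fm' : B ⟶ B''}
    {φ' : A' ⟶ B''} (hF : PreFrobenioid.IsFrobeniusType C.toElem Fm)
    (hF' : PreFrobenioid.IsFrobeniusType C.toElem Fm') (hsq : Fm ≫ φ' = φ ≫ Fm') :
    pull C.divisorMonoid (ModelFrobenioid.baseMap Fm) (ModelFrobenioid.div φ') =
      ModelFrobenioid.div φ ^ (ModelFrobenioid.degFr Fm' : ℕ) := by
  have h := congrArg ModelFrobenioid.div hsq
  have hF1 : ModelFrobenioid.div Fm = 1 := hF.1.2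
  have hF1' : ModelFrobenioid.div Fm' = 1 := hF'.1.2
  rw [ModelFrobenioid.div_comp, ModelFrobenioid.div_comp, hF1, one_pow, mul_one, hF1', map_one,
    one_mul] at h
  exact h

/-- The morphism of Frobenius type `(d, id, 0, 0) : (A_D, α) → (A_D, d·α)` of the model Frobenioid of `C`
([FrdI] Thm 5.2, proof of (ii), p.101; L1 `ModelFrobenioid.powUnitHom`).
[cite: MochizukiFrdI2008, Thm. 5.2(ii) p.101] -/
theorem isFrobeniusType_powUnitHom (d : ℕ+) (A : C.category) :
    PreFrobenioid.IsFrobeniusType C.toElem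
      (ModelFrobenioid.powUnitHom C.divisorMonoid C.ratFnFunctor C.divBNatTrans d A) :=
  (ModelFrobenioid.powChoice C.divisorMonoid C.divBNatTrans d C.objectwise_isGroupLike).isFrobeniusType A

/-- The conjugate `(deg_Fr, Base, d·Div, d·u)` of a pre-step along `(d, id, 0, 0)` is a pre-step.
[cite: MochizukiFrdI2008, Prop. 2.1 (i) p.44] -/
theorem isPreStep_powHom (d : ℕ+) {A B : C.category} {φ : A ⟶ B}
    (hφ : PreFrobenioid.IsPreStep C.toElem φ) :
    PreFrobenioid.IsPreStep C.toElem (ModelFrobenioid.powHom d φ) :=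
  ⟨show ModelFrobenioid.degFr (ModelFrobenioid.powHom d φ) = 1 from hφ.1,
    show IsIso (ModelFrobenioid.baseMap (ModelFrobenioid.powHom d φ)) from hφ.2⟩

/-- **Non-cuspidality of an arbitrary pre-step, categorically** (the "factorization homomorphism" step of
the printed proof, p.82): the zero divisor of a pre-step `φ : A → B` is non-cuspidal iff for every square
`φ' ∘ F = F' ∘ φ` with `F`, `F'` of Frobenius type and `φ'` a pre-step, every PRIMARY pre-step `π`
through which `φ'` factors admits a base-field-theoretic pre-step factoring through it.
[cite: MochizukiEtTh2009, Cor 3.8 p.82] -/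
theorem isNonCuspidal_div_iff_frobenius (hp : C.IsCuspidallyPure)
    (hD1 : ∀ (A : Dᵒᵖ) (y : C.Φ.carrier A), C.IsBaseFieldTheoreticDiv y → C.IsNonCuspidal y)
    (hDn : ∀ (A : Dᵒᵖ) (x : C.Φ.carrier A),
      C.IsNonCuspidal x ↔ ∀ y : C.Φ.carrier A, IsPrimary y → Precsim y x → C.IsNonCuspidal y)
    {A B : C.category} {φ : A ⟶ B} (hφ : PreFrobenioid.IsPreStep C.toElem φ) :
    C.IsNonCuspidal (ModelFrobenioid.div φ) ↔
      ∀ ⦃A' B'' Z : C.category⦄ (Fm : A ⟶ A') (Fm' : B ⟶ B'') (φ' : A' ⟶ B'') (π : A' ⟶ Z)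
        (χ : Z ⟶ B''),
        PreFrobenioid.IsFrobeniusType C.toElem Fm → PreFrobenioid.IsFrobeniusType C.toElem Fm' →
        PreFrobenioid.IsPreStep C.toElem φ' → Fm ≫ φ' = φ ≫ Fm' →
        PreFrobenioid.IsPrimaryPreStep C.toElem π → π ≫ χ = φ' →
          ∃ (B₃ : C.category) (ψ : A' ⟶ B₃) (χ' : Z ⟶ B₃),
            PreFrobenioid.IsPreStep C.toElem ψ ∧ C.IsBaseFieldTheoretic ψ ∧ π ≫ χ' = ψ := by
  constructor
  · intro hn A' B'' Z Fm Fm' φ' π χ hFm hFm' hφ' hsq hπ hπχ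
    haveI : IsIso (ModelFrobenioid.baseMap Fm) := hFm.2
    -- `Base(F)^* Div(π) ≤ d · Div(φ)` is primary, hence non-cuspidal, hence below a bs-fld divisor
    have hy : ModelFrobenioid.div π ∣ ModelFrobenioid.div φ' := div_dvd_div_of_comp_eq χ hφ' hπχ
    have hpull : pull C.divisorMonoid (ModelFrobenioid.baseMap Fm) (ModelFrobenioid.div π) ∣
        ModelFrobenioid.div φ ^ (ModelFrobenioid.degFr Fm' : ℕ) := by
      rw [← pull_div_eq_pow_of_square hFm hFm' hsq]
      exact map_dvd _ hy
    have hprim : IsPrimary (pull C.divisorMonoid (ModelFrobenioid.baseMap Fm) (ModelFrobenioid.div π)) :=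
      (PreFrobenioid.isPrimary_pull_iff (ModelFrobenioid.baseMap Fm) _).2 hπ.2
    have hn' : C.IsNonCuspidal (pull C.divisorMonoid (ModelFrobenioid.baseMap Fm) (ModelFrobenioid.div π)) :=
      (hDn _ _).1 hn _ hprim ⟨_, (ModelFrobenioid.degFr Fm').pos, hpull⟩
    obtain ⟨z, hz, hwz⟩ :
        ∃ z : C.divisorMonoid.obj (op A.base), C.IsBaseFieldTheoreticDiv z ∧
          pull C.divisorMonoid (ModelFrobenioid.baseMap Fm) (ModelFrobenioid.div π) ∣ z :=
      hp.exists_bsFld_dvd _ _ hprim hn'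
    -- transport `z` to `A'` along `Base(F)⁻¹`
    have hz' : C.IsBaseFieldTheoreticDiv
        (pull C.divisorMonoid (inv (ModelFrobenioid.baseMap Fm)) z) := isBaseFieldTheoreticDiv_pull _ hz
    have hyz' : ModelFrobenioid.div π ∣ pull C.divisorMonoid (inv (ModelFrobenioid.baseMap Fm)) z := by
      have h := map_dvd (pull C.divisorMonoid (inv (ModelFrobenioid.baseMap Fm))) hwz
      rwa [PreFrobenioid.pull_inv_pull_eq] at h
    obtain ⟨B₃, ψ, hψ, hψd⟩ := exists_isPreStep_div_eq A' (pull C.divisorMonoid (inv (ModelFrobenioid.baseMap Fm)) z)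
    obtain ⟨χ', hχ'⟩ := exists_comp_eq_of_div_dvd hπ.1 hψ (hψd ▸ hyz')
    refine ⟨B₃, ψ, χ', hψ, ?_, hχ'⟩
    show C.IsBaseFieldTheoreticDiv (ModelFrobenioid.div ψ)
    rw [hψd]
    exact hz'
  · intro H
    rw [hDn]
    rintro y hy ⟨n, hn, hyx⟩
    let d : ℕ+ := ⟨n, hn⟩
    have hFm := isFrobeniusType_powUnitHom d A
    have hFm' := isFrobeniusType_powUnitHom d B
    have hφ' : PreFrobenioid.IsPreStep C.toElem (ModelFrobenioid.powHom d φ) := isPreStep_powHom d hφ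
    have hsq := ModelFrobenioid.powUnitHom_comp_powHom C.divisorMonoid C.ratFnFunctor C.divBNatTrans d φ
    obtain ⟨Z, π, hπ, hπd⟩ :=
      exists_isPreStep_div_eq (ModelFrobenioid.powObj C.divisorMonoid C.ratFnFunctor C.divBNatTrans d A) y
    have hyx' : ModelFrobenioid.div π ∣ ModelFrobenioid.div (ModelFrobenioid.powHom d φ) := by
      rw [hπd, ModelFrobenioid.div_powHom]
      exact hyx
    obtain ⟨χ, hχ⟩ := exists_comp_eq_of_div_dvd hπ hφ' hyx'
    have hπp : PreFrobenioid.IsPrimaryPreStep C.toElem π :=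
      ⟨hπ, show IsPrimary (ModelFrobenioid.div π) by rw [hπd]; exact hy⟩
    obtain ⟨B₃, ψ, χ', hψ, hψb, hπχ'⟩ := H _ _ _ π χ hFm hFm' hφ' hsq hπp hχ
    have h : C.IsNonCuspidal (ModelFrobenioid.div π) :=
      (C.isNonCuspidal_iff_exists_bsFld_dvd hp hD1 hDn hπp.2).2
        ⟨ModelFrobenioid.div ψ, hψb, div_dvd_div_of_comp_eq χ' hψ hπχ'⟩
    rwa [hπd] at h

/-- **Cuspidality of an arbitrary pre-step, categorically** (Def 3.6 (v)(b) + the factorization step of the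
printed proof, p.82): the zero divisor of a pre-step `φ : A → B` is cuspidal iff for every square
`φ' ∘ F = F' ∘ φ` with `F`, `F'` of Frobenius type and `φ'` a pre-step, NO primary pre-step `π` through
which `φ'` factors admits a base-field-theoretic pre-step factoring through it.
[cite: MochizukiEtTh2009, Cor 3.8 p.82] -/
theorem isCuspidal_div_iff_frobenius (hp : C.IsCuspidallyPure)
    (hD1 : ∀ (A : Dᵒᵖ) (y : C.Φ.carrier A), C.IsBaseFieldTheoreticDiv y → C.IsNonCuspidal y)
    (hDa : ∀ (A : Dᵒᵖ) (x : C.Φ.carrier A), C.IsNonCuspidal x → C.IsCuspidal x → x = 1)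
    (hDn : ∀ (A : Dᵒᵖ) (x : C.Φ.carrier A),
      C.IsNonCuspidal x ↔ ∀ y : C.Φ.carrier A, IsPrimary y → Precsim y x → C.IsNonCuspidal y)
    (hDc : ∀ (A : Dᵒᵖ) (x : C.Φ.carrier A),
      C.IsCuspidal x ↔ ∀ y : C.Φ.carrier A, IsPrimary y → Precsim y x → C.IsCuspidal y)
    {A B : C.category} {φ : A ⟶ B} (hφ : PreFrobenioid.IsPreStep C.toElem φ) :
    C.IsCuspidal (ModelFrobenioid.div φ) ↔
      ∀ ⦃A' B'' Z : C.category⦄ (Fm : A ⟶ A') (Fm' : B ⟶ B'') (φ' : A' ⟶ B'') (π : A' ⟶ Z)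
        (χ : Z ⟶ B''),
        PreFrobenioid.IsFrobeniusType C.toElem Fm → PreFrobenioid.IsFrobeniusType C.toElem Fm' →
        PreFrobenioid.IsPreStep C.toElem φ' → Fm ≫ φ' = φ ≫ Fm' →
        PreFrobenioid.IsPrimaryPreStep C.toElem π → π ≫ χ = φ' →
          ¬ ∃ (B₃ : C.category) (ψ : A' ⟶ B₃) (χ' : Z ⟶ B₃),
            PreFrobenioid.IsPreStep C.toElem ψ ∧ C.IsBaseFieldTheoretic ψ ∧ π ≫ χ' = ψ := by
  constructor
  · rintro hc A' B'' Z Fm Fm' φ' π χ hFm hFm' hφ' hsq hπ hπχ ⟨B₃, ψ, χ', hψ, hψb, hπχ'⟩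
    haveI : IsIso (ModelFrobenioid.baseMap Fm) := hFm.2
    have hy : ModelFrobenioid.div π ∣ ModelFrobenioid.div φ' := div_dvd_div_of_comp_eq χ hφ' hπχ
    have hpull : pull C.divisorMonoid (ModelFrobenioid.baseMap Fm) (ModelFrobenioid.div π) ∣
        ModelFrobenioid.div φ ^ (ModelFrobenioid.degFr Fm' : ℕ) := by
      rw [← pull_div_eq_pow_of_square hFm hFm' hsq]
      exact map_dvd _ hy
    have hprim : IsPrimary (pull C.divisorMonoid (ModelFrobenioid.baseMap Fm) (ModelFrobenioid.div π)) :=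
      (PreFrobenioid.isPrimary_pull_iff (ModelFrobenioid.baseMap Fm) _).2 hπ.2
    -- the pulled-back primary divisor is cuspidal (below `d · Div(φ)`) …
    have hwc : C.IsCuspidal (pull C.divisorMonoid (ModelFrobenioid.baseMap Fm) (ModelFrobenioid.div π)) :=
      (hDc _ _).1 hc _ hprim ⟨_, (ModelFrobenioid.degFr Fm').pos, hpull⟩
    -- … and non-cuspidal (below the pull-back of the bs-fld divisor `Div(ψ)`)
    have hwn : C.IsNonCuspidal (pull C.divisorMonoid (ModelFrobenioid.baseMap Fm) (ModelFrobenioid.div π)) :=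
      C.isNonCuspidal_of_dvd hDn (map_dvd _ (div_dvd_div_of_comp_eq χ' hψ hπχ'))
        (hD1 _ _ (isBaseFieldTheoreticDiv_pull _ hψb))
    exact hprim.1 (hDa _ _ hwn hwc)
  · intro H
    rw [hDc]
    rintro y hy ⟨n, hn, hyx⟩
    rw [C.isCuspidal_iff_not_isNonCuspidal hp hDa hy]
    intro hny
    let d : ℕ+ := ⟨n, hn⟩
    have hFm := isFrobeniusType_powUnitHom d A
    have hFm' := isFrobeniusType_powUnitHom d B
    have hφ' : PreFrobenioid.IsPreStep C.toElem (ModelFrobenioid.powHom d φ) := isPreStep_powHom d hφ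
    have hsq := ModelFrobenioid.powUnitHom_comp_powHom C.divisorMonoid C.ratFnFunctor C.divBNatTrans d φ
    obtain ⟨Z, π, hπ, hπd⟩ :=
      exists_isPreStep_div_eq (ModelFrobenioid.powObj C.divisorMonoid C.ratFnFunctor C.divBNatTrans d A) y
    have hyx' : ModelFrobenioid.div π ∣ ModelFrobenioid.div (ModelFrobenioid.powHom d φ) := by
      rw [hπd, ModelFrobenioid.div_powHom]
      exact hyx
    obtain ⟨χ, hχ⟩ := exists_comp_eq_of_div_dvd hπ hφ' hyx'
    have hπp : PreFrobenioid.IsPrimaryPreStep C.toElem π :=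
      ⟨hπ, show IsPrimary (ModelFrobenioid.div π) by rw [hπd]; exact hy⟩
    refine H _ _ _ π χ hFm hFm' hφ' hsq hπp hχ ?_
    have hny' : C.IsNonCuspidal (ModelFrobenioid.div π) := by rw [hπd]; exact hny
    exact (isNonCuspidal_div_iff_exists_factor hp hD1 hDn hπ hπp.2).1 hny'

end TemperedFrobenioid

end Literature.AnabelianGeometry.EtaleTheta
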